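import Summits.BirchSwinnertonDyer.BirchSwinnertonDyer.Theses.SignedBalanceX9
import Summits.BirchSwinnertonDyer.BirchSwinnertonDyer.Theorems.TwinTransportX9Rung648a1
import Literature.NumberTheory.EllipticCurves.KrizLi2019.ThreeClassNumbers
import HarnessLib

/-!
# BC5 witness rung for `SignedBalanceX9.TwistedAnalyticMuZeroCoprimeX9` (item stmt-BirchSwinnertonDyer-25216) at the pair `(648a1, 5)`

The crux (LINE 7 «coprime class-number frames» of route `route-BirchSwinnertonDyer-SignedBalanceX9`) asks, for
every X9 pair `(W, p)`, for a BCS-admissible frame `(d_K, d_F)` with `p ∤ h_K` for EVERY imaginary quadratic field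
of discriminant `d_K`, such that the three quadratic twists `W^{d_K}, W^{d_F}, W^{d_K d_F}` carry the unit-coefficient
certificate `TwistHasUnitCoeff` ("analytic `μ = 0`").

This file decides the crux body AT `(648a1, 5)` with the frame `(d_K, d_F) = (-71, 73)`:
* DECIDED IN THE KERNEL: BCS-admissibility of `(-71, 73)` for `648a1` at `5` (tree theorem
  `TwinTransportX9Rung.bcsAdmissiblePair_648a1`), and the COPRIMALITY CLAUSE `5 ∤ h_K` for every imaginary
  quadratic `K` with `d_K = -71`: `h_K = h(-71) = #{reduced primitive forms of discriminant -71} = 7` by Cox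
  Thm. 7.7 (ii) + Thm. 2.13 (tree `Quadratic.card_reducedForms_eq_classNumber`, the sharp box of
  `KrizLi2019.ThreeClassNumbers`, `decide`), and `5 ∤ 7`.
* DISPLAYED BINDERS (not rechecked in the kernel): the three analytic clauses `TwistHasUnitCoeff 648a1 5 d`,
  `d ∈ {-71, 73, -71·73}` — certified numerically by the instrument FRAME-CERT-v2 (PARI overconvergent modular
  symbols `mspadicmoments` with the `D`-twist, kit job j298358 group A2, row `648a1 frame (-71,73) h=7`: all four
  members `μ_an = 0`, unit coefficient at index `λ_an`; report `pub/ideators/bsd-idea-2/line8/FRAME-CERT-v2.txt`,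
  evidence on stmt-BirchSwinnertonDyer-25216).
WITNESS OF WEAKNESS (T3): `648a1` at `p = 5` is an X9 pair (image `5S4`, not surjective), outside BCS 2025
Thm. 1.1.2 (b) ((sur)/(im) fail) and outside every verified-BSD₅ table in the tree; `BSD₅(648a1)` is not known
while this instance of the crux holds. No summit, leaf or crux is proved by this file; BSD is NOT proved.

References: Cox 2013 Thm. 2.13, Thm. 7.7 (ii) [Cox2013]; Burungale–Castella–Skinner 2025 §1.2, Prop. 5.2.1
[BurungaleCastellaSkinner2025]; Mazur–Tate–Teitelbaum 1986 §I.11–13 [MazurTateTeitelbaum1986Invent];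
Greenberg LNM 1716 Conj. 1.11 [GreenbergLNM1716]; Cremona's tables (label 648a1) [Cremona2006].
-/

set_option linter.dupNamespace false
set_option autoImplicit false

noncomputable section

open scoped Classical NumberField

open Module NumberField WeierstrassCurve Literature.NumberTheory.EllipticCurves
  Literature.NumberTheory.QuadraticFields Literature.NumberTheory.QuadraticFields.Quadratic
  Literature.NumberTheory.QuadraticFields.BinaryQuadraticForm
  Summit.BirchSwinnertonDyer.BirchSwinnertonDyer.Rank1Residual
  Summit.BirchSwinnertonDyer.BirchSwinnertonDyer.Theses.SignedBalanceX9
  Summit.BirchSwinnertonDyer.BirchSwinnertonDyer.Theorems.TwinTransportX9Rung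

namespace Summit.BirchSwinnertonDyer.BirchSwinnertonDyer.Theorems.SignedBalanceX9Rung

/-! ## §1 The coprimality clause: `h(-71) = 7`, so `5 ∤ h_K` for every imaginary quadratic `K` with `d_K = -71` -/

/-- The sharp box `a ≤ 4` holds the `7` reduced primitive forms of discriminant `-71`
(`(1,±1,18), (2,±1,9), (3,±1,6), (4,±3,5)` up to the reduction convention). [cite: Cox2013, §2.A Thm. 2.13, (2.14)] -/
theorem card_reducedFormsSharp_neg71 : (reducedFormsSharp (-71) 4).card = 7 := by
  decide +kernel

/-- **`5 ∤ h_K` for every imaginary quadratic field of discriminant `-71`** (`h_K = h(-71) = 7`).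
[cite: Cox2013, §7.B Thm. 7.7 (ii) and §2.A Thm. 2.13] -/
theorem not_five_dvd_classNumber_of_discr_neg71 :
    ∀ (K : Type) [Field K] [NumberField K], IsImaginaryQuadratic K →
      NumberField.discr K = -71 → ¬ 5 ∣ NumberField.classNumber K := by
  intro K _ _ hK hd
  have h2 : finrank ℚ K = 2 := hK.1
  rw [← card_reducedForms_eq_classNumber h2 (by rw [hd]; norm_num), hd, BinaryQuadraticForm.classNumber,
    reducedForms_eq_reducedFormsSharp (show ((-71 : ℤ)) < 0 by norm_num) (A := 4) (by norm_num),
    card_reducedFormsSharp_neg71]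
  decide

/-! ## §2 The instance and the rung -/

/-- The crux `TwistedAnalyticMuZeroCoprimeX9` specialises to the body below at `(648a1, 5)` (so the rung's
statement IS the crux's instance). -/
theorem rung_isInstance_648a1_5 (h : TwistedAnalyticMuZeroCoprimeX9) :
    haveI := isElliptic_648a1; haveI := isGloballyMinimal_648a1; haveI : Fact (Nat.Prime 5) := ⟨by norm_num⟩
    ClassX9 (⟨0, 0, 0, -3, 14⟩ : WeierstrassCurve ℚ) 5 →
      ∃ dK dF : ℤ, BCSAdmissiblePair (⟨0, 0, 0, -3, 14⟩ : WeierstrassCurve ℚ) 5 dK dF ∧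
        (∀ (K : Type) [Field K] [NumberField K], IsImaginaryQuadratic K →
          NumberField.discr K = dK → ¬ 5 ∣ NumberField.classNumber K) ∧
        TwistHasUnitCoeff (⟨0, 0, 0, -3, 14⟩ : WeierstrassCurve ℚ) 5 dK ∧
        TwistHasUnitCoeff (⟨0, 0, 0, -3, 14⟩ : WeierstrassCurve ℚ) 5 dF ∧
        TwistHasUnitCoeff (⟨0, 0, 0, -3, 14⟩ : WeierstrassCurve ℚ) 5 (dK * dF) :=
  @h (⟨0, 0, 0, -3, 14⟩ : WeierstrassCurve ℚ) isElliptic_648a1 isGloballyMinimal_648a1 5 ⟨by norm_num⟩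

/-- **THE RUNG.** The crux body at `(648a1, 5)`, witnessed by the coprime admissible frame `(d_K, d_F) = (-71, 73)`
(`h(-71) = 7`, `5 ∤ 7`; admissibility and coprimality decided in the kernel), with the three analytic
unit-coefficient clauses as DISPLAYED binders (instrument FRAME-CERT-v2, kit j298358, row 648a1). BSD is NOT proved.
[cite: Cox2013, §7.B Thm. 7.7 (ii)] [cite: BurungaleCastellaSkinner2025, §1.2, Prop. 5.2.1]
[cite: MazurTateTeitelbaum1986Invent, §I.11–§I.13] -/
theorem rung_648a1_5
    (hμK : haveI : Fact (Nat.Prime 5) := ⟨by norm_num⟩; TwistHasUnitCoeff (⟨0, 0, 0, -3, 14⟩ : WeierstrassCurve ℚ) 5 (-71))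
    (hμF : haveI : Fact (Nat.Prime 5) := ⟨by norm_num⟩; TwistHasUnitCoeff (⟨0, 0, 0, -3, 14⟩ : WeierstrassCurve ℚ) 5 73)
    (hμKF : haveI : Fact (Nat.Prime 5) := ⟨by norm_num⟩; TwistHasUnitCoeff (⟨0, 0, 0, -3, 14⟩ : WeierstrassCurve ℚ) 5 (-71 * 73)) :
    haveI := isElliptic_648a1; haveI := isGloballyMinimal_648a1; haveI : Fact (Nat.Prime 5) := ⟨by norm_num⟩
    ClassX9 (⟨0, 0, 0, -3, 14⟩ : WeierstrassCurve ℚ) 5 →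
      ∃ dK dF : ℤ, BCSAdmissiblePair (⟨0, 0, 0, -3, 14⟩ : WeierstrassCurve ℚ) 5 dK dF ∧
        (∀ (K : Type) [Field K] [NumberField K], IsImaginaryQuadratic K →
          NumberField.discr K = dK → ¬ 5 ∣ NumberField.classNumber K) ∧
        TwistHasUnitCoeff (⟨0, 0, 0, -3, 14⟩ : WeierstrassCurve ℚ) 5 dK ∧
        TwistHasUnitCoeff (⟨0, 0, 0, -3, 14⟩ : WeierstrassCurve ℚ) 5 dF ∧
        TwistHasUnitCoeff (⟨0, 0, 0, -3, 14⟩ : WeierstrassCurve ℚ) 5 (dK * dF) := by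
  haveI := isElliptic_648a1; haveI := isGloballyMinimal_648a1
  intro _
  exact ⟨-71, 73, bcsAdmissiblePair_648a1, not_five_dvd_classNumber_of_discr_neg71, hμK, hμF, hμKF⟩

end Summit.BirchSwinnertonDyer.BirchSwinnertonDyer.Theorems.SignedBalanceX9Rung

end
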